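import Literature.Probability.Process.BurkholderSubordination
import Mathlib.Analysis.SpecialFunctions.Sqrt
import Mathlib.Analysis.Convex.Deriv
import Mathlib.Tactic.FieldSimp
import Mathlib.Tactic.Linarith
import HarnessLib

/-!
# FunctionalMining — towards `BurkConcave` (1): region-wise concavity of Burkholder's pieces along a line

search for candidate a priori estimates; no regularity claim.  Cell `pub-nsfunc`, prove seat gen 7.  First bricks for the
DISCHARGE of the typed hypothesis `Laminate.BurkConcave` (file `StretchingLaminateBurkholderConcave`; Burkholder 1991, LNM 1464,
§8, (8.11)–(8.16)): along a line `t ↦ (x + th, y + tk)` the squared norms are quadratics `q(t) = a + 2bt + ct²`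
(`a = ‖x‖²`, `b = ⟨x,h⟩`, `c = ‖h‖²`) and `p(t) = d + 2et + ft²`, with `e² ≤ df` (Cauchy–Schwarz) and `f ≤ c` (subordination).
This file proves, as pure one-variable calculus over real parameters, that each CLOSED-FORM PIECE of `u_λ` is concave in `t`
on any open interval where it is smooth: `D₀` and `D₃` (concave quadratics, `f ≤ c`), `D₄` (constant), and `D₁`
(`2α(1−R)e^{R+Z−λ−1}`, `R = √q`, `Z = √p`): Burkholder's (8.13) in the signed form
`G'' = 2αe^{R+Z−λ−1}·(−R(u/R + v/Z)² − (c − f) − (df − e²)(R + Z − 1)/Z³) ≤ 0` on `{q > 0, p > 0, R + Z ≥ 1}`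
(`u = b + ct`, `v = e + ft`), and `D₂` (`(1−q)/((λ−Z)²+1−q)`): Burkholder's `G'' = −2D⁻³(A+B+C)` with `A, B, C ≥ 0` on
`{p > 0, q < 1, Z < λ, (λ−1−Z)² ≤ q}` (appended).  NOT here: the seams, the sphere endpoints, and the assembly of
`BurkConcave` (roadmap: prove seat HANDOFF gen 7 → 8).  Nothing about Navier–Stokes.
-/

noncomputable section

namespace Summit.NavierStokesRegularity.FunctionalMining

namespace Burk

open Literature.Probability.Process Set

/-! ## Derivatives of `√(a + 2bt + ct²)` -/

/-- `d/dt (a + 2bt + ct²) = 2(b + ct)`. [ours; bookkeeping] -/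
theorem hasDerivAt_quad (a b c t : ℝ) :
    HasDerivAt (fun s => a + 2 * b * s + c * s ^ 2) (2 * (b + c * t)) t := by
  have h1 : HasDerivAt (fun s : ℝ => 2 * b * s) (2 * b) t := by
    simpa using (hasDerivAt_id t).const_mul (2 * b)
  have h2 : HasDerivAt (fun s : ℝ => c * s ^ 2) (c * (2 * t)) t := by
    simpa using (hasDerivAt_pow 2 t).const_mul c
  have h3 := (h1.add h2).const_add a
  have e : (fun s : ℝ => a + 2 * b * s + c * s ^ 2) = fun s => a + (2 * b * s + c * s ^ 2) := by
    funext s; ring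
  rw [e]
  exact h3.congr_deriv (by ring)

/-- `d/dt √(a + 2bt + ct²) = (b + ct)/√(a + 2bt + ct²)` where the quadratic is positive. [ours; bookkeeping] -/
theorem hasDerivAt_sqrt_quad (a b c t : ℝ) (h : 0 < a + 2 * b * t + c * t ^ 2) :
    HasDerivAt (fun s => Real.sqrt (a + 2 * b * s + c * s ^ 2))
      ((b + c * t) / Real.sqrt (a + 2 * b * t + c * t ^ 2)) t := by
  have hd := (hasDerivAt_quad a b c t).sqrt h.ne'
  convert hd using 1
  field_simp

/-! ## `D₀`, `D₃`, `D₄`: concave quadratics and a constant -/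

/-- A quadratic `t ↦ κ + μt + νt²` with `ν ≤ 0` is concave. [ours; elementary] -/
theorem concaveOn_quadratic {κ μ ν : ℝ} (hν : ν ≤ 0) {J : Set ℝ} (hJ : Convex ℝ J) :
    ConcaveOn ℝ J (fun t => κ + μ * t + ν * t ^ 2) := by
  have hsq : ConvexOn ℝ J (fun t : ℝ => t ^ 2) :=
    (Even.convexOn_pow (by decide : Even 2)).subset (subset_univ _) hJ
  have h1 : ConcaveOn ℝ J (fun t : ℝ => ν * t ^ 2) := by
    have := (hsq.smul (show 0 ≤ -ν by linarith)).neg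
    refine this.congr ?_
    intro t _
    simp only [Pi.neg_apply, smul_eq_mul]
    ring
  have h2 : ConcaveOn ℝ J (fun t : ℝ => κ + μ * t) := by
    refine ⟨hJ, fun x _ y _ a b _ _ hab => ?_⟩
    simp only [smul_eq_mul]
    have : a * (κ + μ * x) + b * (κ + μ * y) = κ + μ * (a * x + b * y) := by
      calc a * (κ + μ * x) + b * (κ + μ * y) = (a + b) * κ + μ * (a * x + b * y) := by ring
        _ = κ + μ * (a * x + b * y) := by rw [hab, one_mul]
    rw [this]
  refine (h2.add h1).congr ?_
  intro t _
  simp only [Pi.add_apply]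

/-- **Piece `D₀` along a line is concave**: `t ↦ α(1 + p(t) − q(t))e^{−λ}` with `f ≤ c`. [ours; elementary] -/
theorem concaveOn_D0_line (lam a b c d e f : ℝ) (hcf : f ≤ c) {J : Set ℝ} (hJ : Convex ℝ J) :
    ConcaveOn ℝ J (fun t => burkholderAlpha * (1 + (d + 2 * e * t + f * t ^ 2) - (a + 2 * b * t + c * t ^ 2))
      * Real.exp (-lam)) := by
  have hk : 0 ≤ burkholderAlpha * Real.exp (-lam) := (mul_pos burkholderAlpha_pos (Real.exp_pos _)).le
  have hq := concaveOn_quadratic (κ := 1 + d - a) (μ := 2 * e - 2 * b) (ν := f - c) (by linarith) hJ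
  have := hq.smul hk
  refine this.congr ?_  -- pointwise equality
  intro t _
  simp only [smul_eq_mul]; ring

/-- **Piece `D₃` along a line is concave**: `t ↦ 1 − (λ² − 1 − p(t) + q(t))/(4(λ−1))`, `f ≤ c`, `λ > 1`. [ours; elementary] -/
theorem concaveOn_D3_line (lam a b c d e f : ℝ) (hlam : 1 < lam) (hcf : f ≤ c) {J : Set ℝ} (hJ : Convex ℝ J) :
    ConcaveOn ℝ J (fun t => 1 - (lam ^ 2 - 1 - (d + 2 * e * t + f * t ^ 2) + (a + 2 * b * t + c * t ^ 2))
      / (4 * (lam - 1))) := by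
  have hl : 0 < 4 * (lam - 1) := by linarith
  have hq := concaveOn_quadratic (κ := 1 - (lam ^ 2 - 1 - d + a) / (4 * (lam - 1)))
    (μ := (2 * e - 2 * b) / (4 * (lam - 1))) (ν := (f - c) / (4 * (lam - 1)))
    (div_nonpos_of_nonpos_of_nonneg (by linarith) hl.le) hJ
  refine hq.congr ?_
  intro t _
  field_simp
  ring

/-- Piece `D₄` (the constant `1`) is concave. [ours; bookkeeping] -/
theorem concaveOn_D4_line {J : Set ℝ} (hJ : Convex ℝ J) : ConcaveOn ℝ J (fun _ : ℝ => (1 : ℝ)) :=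
  concaveOn_const 1 hJ

/-! ## `D₁`: `2α(1 − R)e^{R+Z−λ−1}` is concave along a line where `q, p > 0` and `R + Z ≥ 1` (Burkholder (8.13)) -/

/-- **Piece `D₁` along a line is concave** (Burkholder 1991, (8.13), in the signed form
`G'' = 2αe^{R+Z−λ−1}·(−R(u/R + v/Z)² − (c − f) − (fZ² − v²)(R + Z − 1)/Z³)`, `u = b + ct`, `v = e + ft`, `fZ² − v² = df − e² ≥ 0`):
for `e² ≤ df`, `f ≤ c`, on an open convex `J` with `q, p > 0` and `√q + √p ≥ 1`, the function
`t ↦ 2α(1 − √q(t))e^{√q(t) + √p(t) − λ − 1}` is concave.  (No sign condition on `1 − √q` is needed.) [ours; elementary] -/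
theorem concaveOn_D1_line (lam a b c d e f : ℝ) (hΔ : e ^ 2 ≤ d * f) (hcf : f ≤ c)
    {J : Set ℝ} (hJo : IsOpen J) (hJc : Convex ℝ J)
    (hq : ∀ t ∈ J, 0 < a + 2 * b * t + c * t ^ 2) (hp : ∀ t ∈ J, 0 < d + 2 * e * t + f * t ^ 2)
    (h1 : ∀ t ∈ J, 1 ≤ Real.sqrt (a + 2 * b * t + c * t ^ 2) + Real.sqrt (d + 2 * e * t + f * t ^ 2)) :
    ConcaveOn ℝ J (fun t => 2 * burkholderAlpha * (1 - Real.sqrt (a + 2 * b * t + c * t ^ 2))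
      * Real.exp (Real.sqrt (a + 2 * b * t + c * t ^ 2) + Real.sqrt (d + 2 * e * t + f * t ^ 2) - lam - 1)) := by
  obtain ⟨R, hR⟩ : ∃ R : ℝ → ℝ, R = fun s => Real.sqrt (a + 2 * b * s + c * s ^ 2) := ⟨_, rfl⟩
  obtain ⟨Z, hZ⟩ : ∃ Z : ℝ → ℝ, Z = fun s => Real.sqrt (d + 2 * e * s + f * s ^ 2) := ⟨_, rfl⟩
  have hF : (fun t => 2 * burkholderAlpha * (1 - Real.sqrt (a + 2 * b * t + c * t ^ 2))
      * Real.exp (Real.sqrt (a + 2 * b * t + c * t ^ 2) + Real.sqrt (d + 2 * e * t + f * t ^ 2) - lam - 1))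
      = fun t => 2 * burkholderAlpha * (1 - R t) * Real.exp (R t + Z t - lam - 1) := by
    funext s; rw [hR, hZ]
  rw [hF]
  -- pointwise facts
  have hRpos : ∀ t ∈ J, 0 < R t := fun t ht => by rw [hR]; exact Real.sqrt_pos.2 (hq t ht)
  have hZpos : ∀ t ∈ J, 0 < Z t := fun t ht => by rw [hZ]; exact Real.sqrt_pos.2 (hp t ht)
  have hZsq : ∀ t ∈ J, Z t ^ 2 = d + 2 * e * t + f * t ^ 2 := fun t ht => by
    rw [hZ]; exact Real.sq_sqrt (hp t ht).le
  have h1' : ∀ t ∈ J, 1 ≤ R t + Z t := fun t ht => by rw [hR, hZ]; exact h1 t ht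
  have hRd : ∀ t ∈ J, HasDerivAt R ((b + c * t) / R t) t := fun t ht => by
    rw [hR]; exact hasDerivAt_sqrt_quad a b c t (hq t ht)
  have hZd : ∀ t ∈ J, HasDerivAt Z ((e + f * t) / Z t) t := fun t ht => by
    rw [hZ]; exact hasDerivAt_sqrt_quad d e f t (hp t ht)
  -- the two derivative candidates
  obtain ⟨G1, hG1⟩ : ∃ G1 : ℝ → ℝ, G1 = fun t => 2 * burkholderAlpha * Real.exp (R t + Z t - lam - 1) *
      ((1 - R t) * (e + f * t) / Z t - (b + c * t)) := ⟨_, rfl⟩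
  obtain ⟨G2, hG2⟩ : ∃ G2 : ℝ → ℝ, G2 = fun t => 2 * burkholderAlpha * Real.exp (R t + Z t - lam - 1) *
      (-(R t * ((b + c * t) / R t + (e + f * t) / Z t) ^ 2) - (c - f)
        - (f * Z t ^ 2 - (e + f * t) ^ 2) * (R t + Z t - 1) / Z t ^ 3) := ⟨_, rfl⟩
  -- first derivative
  have hD1 : ∀ t ∈ J, HasDerivAt (fun s => 2 * burkholderAlpha * (1 - R s) * Real.exp (R s + Z s - lam - 1)) (G1 t) t := by
    intro t ht
    have hE : HasDerivAt (fun s => R s + Z s - lam - 1) ((b + c * t) / R t + (e + f * t) / Z t) t :=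
      (((hRd t ht).add (hZd t ht)).sub_const lam).sub_const 1
    have hexp := hE.exp
    have hA : HasDerivAt (fun s => 2 * burkholderAlpha * (1 - R s)) (2 * burkholderAlpha * (0 - (b + c * t) / R t)) t :=
      ((hasDerivAt_const t (1 : ℝ)).sub (hRd t ht)).const_mul _
    have h := hA.mul hexp
    have hR0 : R t ≠ 0 := (hRpos t ht).ne'
    have hZ0 : Z t ≠ 0 := (hZpos t ht).ne'
    refine h.congr_deriv ?_
    rw [hG1]
    field_simp
    ring
  -- second derivative
  have hD2 : ∀ t ∈ J, HasDerivAt G1 (G2 t) t := by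
    intro t ht
    have hR0 : R t ≠ 0 := (hRpos t ht).ne'
    have hZ0 : Z t ≠ 0 := (hZpos t ht).ne'
    have hE : HasDerivAt (fun s => R s + Z s - lam - 1) ((b + c * t) / R t + (e + f * t) / Z t) t :=
      (((hRd t ht).add (hZd t ht)).sub_const lam).sub_const 1
    have hexp : HasDerivAt (fun s => 2 * burkholderAlpha * Real.exp (R s + Z s - lam - 1))
        (2 * burkholderAlpha * (Real.exp (R t + Z t - lam - 1) * ((b + c * t) / R t + (e + f * t) / Z t))) t :=
      hE.exp.const_mul _
    have hv : HasDerivAt (fun s : ℝ => e + f * s) f t := by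
      simpa using ((hasDerivAt_id t).const_mul f).const_add e
    have hu : HasDerivAt (fun s : ℝ => b + c * s) c t := by
      simpa using ((hasDerivAt_id t).const_mul c).const_add b
    have hA : HasDerivAt (fun s => (1 - R s) * (e + f * s)) ((0 - (b + c * t) / R t) * (e + f * t) + (1 - R t) * f) t :=
      ((hasDerivAt_const t (1 : ℝ)).sub (hRd t ht)).mul hv
    have hB : HasDerivAt (fun s => (1 - R s) * (e + f * s) / Z s - (b + c * s))
        ((((0 - (b + c * t) / R t) * (e + f * t) + (1 - R t) * f) * Z t
            - (1 - R t) * (e + f * t) * ((e + f * t) / Z t)) / Z t ^ 2 - c) t :=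
      (hA.div (hZd t ht) hZ0).sub hu
    have h : HasDerivAt (fun s => 2 * burkholderAlpha * Real.exp (R s + Z s - lam - 1) *
        ((1 - R s) * (e + f * s) / Z s - (b + c * s)))
        (2 * burkholderAlpha * (Real.exp (R t + Z t - lam - 1) * ((b + c * t) / R t + (e + f * t) / Z t))
          * ((1 - R t) * (e + f * t) / Z t - (b + c * t))
          + 2 * burkholderAlpha * Real.exp (R t + Z t - lam - 1)
          * ((((0 - (b + c * t) / R t) * (e + f * t) + (1 - R t) * f) * Z t
            - (1 - R t) * (e + f * t) * ((e + f * t) / Z t)) / Z t ^ 2 - c)) t := hexp.mul hB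
    rw [hG1]
    refine h.congr_deriv ?_
    rw [hG2]
    field_simp
    ring
  -- sign of the second derivative
  have hsign : ∀ t ∈ J, G2 t ≤ 0 := by
    intro t ht
    have hRt := hRpos t ht
    have hZt := hZpos t ht
    have hΔ' : 0 ≤ f * Z t ^ 2 - (e + f * t) ^ 2 := by
      rw [hZsq t ht]; nlinarith [hΔ]
    have hpos : 0 < 2 * burkholderAlpha * Real.exp (R t + Z t - lam - 1) :=
      mul_pos (mul_pos (by norm_num) burkholderAlpha_pos) (Real.exp_pos _)
    have hsq : 0 ≤ R t * ((b + c * t) / R t + (e + f * t) / Z t) ^ 2 := mul_nonneg hRt.le (sq_nonneg _)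
    have hlast : 0 ≤ (f * Z t ^ 2 - (e + f * t) ^ 2) * (R t + Z t - 1) / Z t ^ 3 :=
      div_nonneg (mul_nonneg hΔ' (by linarith [h1' t ht])) (by positivity)
    have hbr : -(R t * ((b + c * t) / R t + (e + f * t) / Z t) ^ 2) - (c - f)
        - (f * Z t ^ 2 - (e + f * t) ^ 2) * (R t + Z t - 1) / Z t ^ 3 ≤ 0 := by linarith
    rw [hG2]
    exact mul_nonpos_of_nonneg_of_nonpos hpos.le hbr
  -- continuity from differentiability
  have hcont : ContinuousOn (fun s => 2 * burkholderAlpha * (1 - R s) * Real.exp (R s + Z s - lam - 1)) J :=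
    fun t ht => (hD1 t ht).continuousAt.continuousWithinAt
  have hint : interior J = J := hJo.interior_eq
  refine concaveOn_of_hasDerivWithinAt2_nonpos hJc hcont (f' := G1) (f'' := G2) ?_ ?_ ?_
  · intro t ht; rw [hint] at ht ⊢; exact (hD1 t ht).hasDerivWithinAt
  · intro t ht; rw [hint] at ht ⊢; exact (hD2 t ht).hasDerivWithinAt
  · intro t ht; rw [hint] at ht; exact hsign t ht


/-! ## `D₂`: `(1 − q)/((λ − Z)² + 1 − q)` is concave along a line (Burkholder's `A + B + C ≥ 0`) -/

/-- **Piece `D₂` along a line is concave** (Burkholder 1991, proof of (8.10): `G'' = −2D⁻³(A + B + C)`,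
`D = (λ−Z)² + 1 − q`, `A = (c−f)(λ−Z)²D`, `B = [((λ−Z)² − (1−q))v/Z + 2(λ−Z)u]²`,
`C = (λ−Z)·D·(f − v²/Z²)·(λ − Z − (1−q)/Z)`, all `≥ 0`): for `e² ≤ df`, `f ≤ c`, `λ > 2`, on an open convex `J` with
`p > 0`, `q < 1`, `Z = √p < λ` and the `D₂` condition `(λ − 1 − Z)² ≤ q`, the function `t ↦ (1 − q(t))/((λ − √p(t))² + 1 − q(t))`
is concave (the piece depends on `r` only through `r² = q`, so no `√q` occurs). [ours; elementary] -/
theorem concaveOn_D2_line (lam a b c d e f : ℝ) (hlam : 2 < lam) (hΔ : e ^ 2 ≤ d * f) (hcf : f ≤ c)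
    {J : Set ℝ} (hJo : IsOpen J) (hJc : Convex ℝ J)
    (hp : ∀ t ∈ J, 0 < d + 2 * e * t + f * t ^ 2) (hq1 : ∀ t ∈ J, a + 2 * b * t + c * t ^ 2 < 1)
    (hZl : ∀ t ∈ J, Real.sqrt (d + 2 * e * t + f * t ^ 2) < lam)
    (hD2 : ∀ t ∈ J, (lam - 1 - Real.sqrt (d + 2 * e * t + f * t ^ 2)) ^ 2 ≤ a + 2 * b * t + c * t ^ 2) :
    ConcaveOn ℝ J (fun t => (1 - (a + 2 * b * t + c * t ^ 2))
      / ((lam - Real.sqrt (d + 2 * e * t + f * t ^ 2)) ^ 2 + 1 - (a + 2 * b * t + c * t ^ 2))) := by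
  obtain ⟨Z, hZ⟩ : ∃ Z : ℝ → ℝ, Z = fun s => Real.sqrt (d + 2 * e * s + f * s ^ 2) := ⟨_, rfl⟩
  obtain ⟨q, hq⟩ : ∃ q : ℝ → ℝ, q = fun s => a + 2 * b * s + c * s ^ 2 := ⟨_, rfl⟩
  have hF : (fun t => (1 - (a + 2 * b * t + c * t ^ 2))
      / ((lam - Real.sqrt (d + 2 * e * t + f * t ^ 2)) ^ 2 + 1 - (a + 2 * b * t + c * t ^ 2)))
      = fun t => (1 - q t) / ((lam - Z t) ^ 2 + 1 - q t) := by
    funext s; rw [hZ, hq]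
  rw [hF]
  have hZpos : ∀ t ∈ J, 0 < Z t := fun t ht => by rw [hZ]; exact Real.sqrt_pos.2 (hp t ht)
  have hZsq : ∀ t ∈ J, Z t ^ 2 = d + 2 * e * t + f * t ^ 2 := fun t ht => by
    rw [hZ]; exact Real.sq_sqrt (hp t ht).le
  have hZlam : ∀ t ∈ J, Z t < lam := fun t ht => by rw [hZ]; exact hZl t ht
  have hqv : ∀ t, q t = a + 2 * b * t + c * t ^ 2 := fun t => by rw [hq]
  have hq1' : ∀ t ∈ J, q t < 1 := fun t ht => by rw [hqv]; exact hq1 t ht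
  have hD2' : ∀ t ∈ J, (lam - 1 - Z t) ^ 2 ≤ q t := fun t ht => by rw [hZ, hqv]; exact hD2 t ht
  have hDpos : ∀ t ∈ J, 0 < (lam - Z t) ^ 2 + 1 - q t := fun t ht => by nlinarith [hq1' t ht, sq_nonneg (lam - Z t)]
  have hZd : ∀ t ∈ J, HasDerivAt Z ((e + f * t) / Z t) t := fun t ht => by
    rw [hZ]; exact hasDerivAt_sqrt_quad d e f t (hp t ht)
  have hqd : ∀ t, HasDerivAt q (2 * (b + c * t)) t := fun t => by rw [hq]; exact hasDerivAt_quad a b c t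
  -- derivative candidates
  obtain ⟨G1, hG1⟩ : ∃ G1 : ℝ → ℝ, G1 = fun t =>
      ((0 - 2 * (b + c * t)) * ((lam - Z t) ^ 2 + 1 - q t)
        - (1 - q t) * (2 * (lam - Z t) * (0 - (e + f * t) / Z t) + 0 - 2 * (b + c * t)))
      / ((lam - Z t) ^ 2 + 1 - q t) ^ 2 := ⟨_, rfl⟩
  obtain ⟨G2, hG2⟩ : ∃ G2 : ℝ → ℝ, G2 = fun t =>
      -2 * ((c - f) * (lam - Z t) ^ 2 * ((lam - Z t) ^ 2 + 1 - q t)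
        + (((lam - Z t) ^ 2 - (1 - q t)) * ((e + f * t) / Z t) + 2 * (lam - Z t) * (b + c * t)) ^ 2
        + (lam - Z t) * ((lam - Z t) ^ 2 + 1 - q t) * (f - ((e + f * t) / Z t) ^ 2)
          * (lam - Z t - (1 - q t) / Z t))
      / ((lam - Z t) ^ 2 + 1 - q t) ^ 3 := ⟨_, rfl⟩
  -- first derivative
  have hD1 : ∀ t ∈ J, HasDerivAt (fun s => (1 - q s) / ((lam - Z s) ^ 2 + 1 - q s)) (G1 t) t := by
    intro t ht
    have hZ0 : Z t ≠ 0 := (hZpos t ht).ne'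
    have hN : HasDerivAt (fun s => 1 - q s) (0 - 2 * (b + c * t)) t := (hasDerivAt_const t (1:ℝ)).sub (hqd t)
    have hLZ : HasDerivAt (fun s => lam - Z s) (0 - (e + f * t) / Z t) t := (hasDerivAt_const t lam).sub (hZd t ht)
    have hD : HasDerivAt (fun s => (lam - Z s) ^ 2 + 1 - q s)
        (2 * (lam - Z t) * (0 - (e + f * t) / Z t) + 0 - 2 * (b + c * t)) t := by
      have h2 := hLZ.pow 2
      have h3 := (h2.add (hasDerivAt_const t (1:ℝ))).sub (hqd t)
      refine h3.congr_deriv ?_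
      simp only [Nat.cast_ofNat]
      ring
    have h := hN.div hD (hDpos t ht).ne'
    rw [hG1]
    exact h
  -- second derivative
  have hD2d : ∀ t ∈ J, HasDerivAt G1 (G2 t) t := by
    intro t ht
    have hZ0 : Z t ≠ 0 := (hZpos t ht).ne'
    have hD0 : (lam - Z t) ^ 2 + 1 - q t ≠ 0 := (hDpos t ht).ne'
    have hu : HasDerivAt (fun s : ℝ => b + c * s) c t := by
      simpa using ((hasDerivAt_id t).const_mul c).const_add b
    have hv : HasDerivAt (fun s : ℝ => e + f * s) f t := by
      simpa using ((hasDerivAt_id t).const_mul f).const_add e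
    have hLZ : HasDerivAt (fun s => lam - Z s) (0 - (e + f * t) / Z t) t := (hasDerivAt_const t lam).sub (hZd t ht)
    have hD : HasDerivAt (fun s => (lam - Z s) ^ 2 + 1 - q s)
        (2 * (lam - Z t) * (0 - (e + f * t) / Z t) + 0 - 2 * (b + c * t)) t := by
      have h2 := hLZ.pow 2
      have h3 := (h2.add (hasDerivAt_const t (1:ℝ))).sub (hqd t)
      refine h3.congr_deriv ?_
      simp only [Nat.cast_ofNat]
      ring
    -- numerator N₁(s) = (0 - 2(b+cs))·D(s) - (1 - q s)·(2(λ - Z s)(0 - (e+fs)/Z s) + 0 - 2(b+cs))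
    have hN' : HasDerivAt (fun s => (0 - 2 * (b + c * s))) (0 - 2 * c) t := (hasDerivAt_const t (0:ℝ)).sub (hu.const_mul 2)
    have hT1 : HasDerivAt (fun s => (0 - 2 * (b + c * s)) * ((lam - Z s) ^ 2 + 1 - q s))
        ((0 - 2 * c) * ((lam - Z t) ^ 2 + 1 - q t)
          + (0 - 2 * (b + c * t)) * (2 * (lam - Z t) * (0 - (e + f * t) / Z t) + 0 - 2 * (b + c * t))) t :=
      hN'.mul hD
    have hvZ : HasDerivAt (fun s => (e + f * s) / Z s) ((f * Z t - (e + f * t) * ((e + f * t) / Z t)) / Z t ^ 2) t :=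
      hv.div (hZd t ht) hZ0
    have hInner : HasDerivAt (fun s => 2 * (lam - Z s) * (0 - (e + f * s) / Z s) + 0 - 2 * (b + c * s))
        (2 * (0 - (e + f * t) / Z t) * (0 - (e + f * t) / Z t)
          + 2 * (lam - Z t) * (0 - (f * Z t - (e + f * t) * ((e + f * t) / Z t)) / Z t ^ 2) + 0 - 2 * c) t := by
      have h1 : HasDerivAt (fun s => 2 * (lam - Z s)) (2 * (0 - (e + f * t) / Z t)) t := hLZ.const_mul 2
      have h2 : HasDerivAt (fun s => 0 - (e + f * s) / Z s) (0 - (f * Z t - (e + f * t) * ((e + f * t) / Z t)) / Z t ^ 2) t :=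
        (hasDerivAt_const t (0:ℝ)).sub hvZ
      have h3 := ((h1.mul h2).add (hasDerivAt_const t (0:ℝ))).sub (hu.const_mul 2)
      refine h3.congr_deriv ?_
      ring
    have hNq : HasDerivAt (fun s => 1 - q s) (0 - 2 * (b + c * t)) t := (hasDerivAt_const t (1:ℝ)).sub (hqd t)
    have hT2 : HasDerivAt (fun s => (1 - q s) * (2 * (lam - Z s) * (0 - (e + f * s) / Z s) + 0 - 2 * (b + c * s)))
        ((0 - 2 * (b + c * t)) * (2 * (lam - Z t) * (0 - (e + f * t) / Z t) + 0 - 2 * (b + c * t)) + (1 - q t) * (2 * (0 - (e + f * t) / Z t) * (0 - (e + f * t) / Z t) + 2 * (lam - Z t) * (0 - (f * Z t - (e + f * t) * ((e + f * t) / Z t)) / Z t ^ 2) + 0 - 2 * c)) t := hNq.mul hInner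
    have hNum : HasDerivAt (fun s => ((0 - 2 * (b + c * s)) * ((lam - Z s) ^ 2 + 1 - q s) - (1 - q s) * (2 * (lam - Z s) * (0 - (e + f * s) / Z s) + 0 - 2 * (b + c * s))))
        (((0 - 2 * c) * ((lam - Z t) ^ 2 + 1 - q t) + (0 - 2 * (b + c * t)) * (2 * (lam - Z t) * (0 - (e + f * t) / Z t) + 0 - 2 * (b + c * t))) - ((0 - 2 * (b + c * t)) * (2 * (lam - Z t) * (0 - (e + f * t) / Z t) + 0 - 2 * (b + c * t)) + (1 - q t) * (2 * (0 - (e + f * t) / Z t) * (0 - (e + f * t) / Z t) + 2 * (lam - Z t) * (0 - (f * Z t - (e + f * t) * ((e + f * t) / Z t)) / Z t ^ 2) + 0 - 2 * c))) t := hT1.sub hT2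
    have hDen : HasDerivAt (fun s => ((lam - Z s) ^ 2 + 1 - q s) ^ 2)
        (2 * ((lam - Z t) ^ 2 + 1 - q t) * (2 * (lam - Z t) * (0 - (e + f * t) / Z t) + 0 - 2 * (b + c * t))) t := by
      have := hD.pow 2
      refine this.congr_deriv ?_
      simp only [Nat.cast_ofNat]
      ring
    have h : HasDerivAt (fun s => ((0 - 2 * (b + c * s)) * ((lam - Z s) ^ 2 + 1 - q s) - (1 - q s) * (2 * (lam - Z s) * (0 - (e + f * s) / Z s) + 0 - 2 * (b + c * s))) / ((lam - Z s) ^ 2 + 1 - q s) ^ 2)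
        (((((0 - 2 * c) * ((lam - Z t) ^ 2 + 1 - q t) + (0 - 2 * (b + c * t)) * (2 * (lam - Z t) * (0 - (e + f * t) / Z t) + 0 - 2 * (b + c * t))) - ((0 - 2 * (b + c * t)) * (2 * (lam - Z t) * (0 - (e + f * t) / Z t) + 0 - 2 * (b + c * t)) + (1 - q t) * (2 * (0 - (e + f * t) / Z t) * (0 - (e + f * t) / Z t) + 2 * (lam - Z t) * (0 - (f * Z t - (e + f * t) * ((e + f * t) / Z t)) / Z t ^ 2) + 0 - 2 * c))) * (((lam - Z t) ^ 2 + 1 - q t) ^ 2) - ((0 - 2 * (b + c * t)) * ((lam - Z t) ^ 2 + 1 - q t) - (1 - q t) * (2 * (lam - Z t) * (0 - (e + f * t) / Z t) + 0 - 2 * (b + c * t))) * (2 * ((lam - Z t) ^ 2 + 1 - q t) * (2 * (lam - Z t) * (0 - (e + f * t) / Z t) + 0 - 2 * (b + c * t)))) / (((lam - Z t) ^ 2 + 1 - q t) ^ 2) ^ 2) t :=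
      hNum.div hDen (pow_ne_zero 2 hD0)
    rw [hG1]
    refine h.congr_deriv ?_
    rw [hG2]
    field_simp
    ring
  -- sign
  have hsign : ∀ t ∈ J, G2 t ≤ 0 := by
    intro t ht
    have hZt := hZpos t ht
    have hDt := hDpos t ht
    have hlz : 0 < lam - Z t := by linarith [hZlam t ht]
    have hfv : 0 ≤ f - ((e + f * t) / Z t) ^ 2 := by
      rw [div_pow, sub_nonneg, div_le_iff₀ (by positivity), hZsq t ht]
      nlinarith [hΔ]
    -- the D₂ inequality λ − Z − (1 − q)/Z ≥ (λ−2)(λ−Z)/Z > 0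
    have hkey : 0 ≤ lam - Z t - (1 - q t) / Z t := by
      rw [sub_nonneg, div_le_iff₀ hZt]
      nlinarith [hD2' t ht, hlz, hlam]
    have hA : 0 ≤ (c - f) * (lam - Z t) ^ 2 * ((lam - Z t) ^ 2 + 1 - q t) :=
      mul_nonneg (mul_nonneg (by linarith) (sq_nonneg _)) hDt.le
    have hB : 0 ≤ (((lam - Z t) ^ 2 - (1 - q t)) * ((e + f * t) / Z t) + 2 * (lam - Z t) * (b + c * t)) ^ 2 :=
      sq_nonneg _
    have hC : 0 ≤ (lam - Z t) * ((lam - Z t) ^ 2 + 1 - q t) * (f - ((e + f * t) / Z t) ^ 2)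
        * (lam - Z t - (1 - q t) / Z t) :=
      mul_nonneg (mul_nonneg (mul_nonneg hlz.le hDt.le) hfv) hkey
    rw [hG2]
    have hD3 : 0 < ((lam - Z t) ^ 2 + 1 - q t) ^ 3 := pow_pos hDt 3
    have : -2 * ((c - f) * (lam - Z t) ^ 2 * ((lam - Z t) ^ 2 + 1 - q t)
        + (((lam - Z t) ^ 2 - (1 - q t)) * ((e + f * t) / Z t) + 2 * (lam - Z t) * (b + c * t)) ^ 2
        + (lam - Z t) * ((lam - Z t) ^ 2 + 1 - q t) * (f - ((e + f * t) / Z t) ^ 2)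
          * (lam - Z t - (1 - q t) / Z t)) ≤ 0 := by linarith
    exact div_nonpos_of_nonpos_of_nonneg this hD3.le
  have hcont : ContinuousOn (fun s => (1 - q s) / ((lam - Z s) ^ 2 + 1 - q s)) J :=
    fun t ht => (hD1 t ht).continuousAt.continuousWithinAt
  have hint : interior J = J := hJo.interior_eq
  refine concaveOn_of_hasDerivWithinAt2_nonpos hJc hcont (f' := G1) (f'' := G2) ?_ ?_ ?_
  · intro t ht; rw [hint] at ht ⊢; exact (hD1 t ht).hasDerivWithinAt
  · intro t ht; rw [hint] at ht ⊢; exact (hD2d t ht).hasDerivWithinAt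
  · intro t ht; rw [hint] at ht; exact hsign t ht

end Burk

end Summit.NavierStokesRegularity.FunctionalMining

end
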